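/-
Copyright (c) 2026. All rights reserved.
Released under Apache 2.0 license as described in the file LICENSE.
Authors: HodgeCM publication cell (pub-hodgecm), GR lane, seat GR-2 (`pub-hodgecm-own-hyp34`).
-/
import Literature.NumberTheory.Weil1964.ArchLeviSectionQuotientSign
import Literature.NumberTheory.Weil1964.ArchPlaceLeviSection
import HarnessLib

/-!
# The archimedean Weil section over the real places of `F` SPLIT in `E` (place type (ii))

Twin of `ArchComplexPlacesSection` (complex places, type (iii)) for the real places of `F` that split in the quadratic
extension `E` — indexed by any finite family `wOfS : κ → {w real place of E}` (the chosen real place of `E` over each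
such place; the other one is `c • w`).  At each `k` the factor `U(J)(E ⊗_F F_v) = U(swap, σ_v(T₀) ⊗ 1)(ℝ × ℝ) ≅ GL_N(ℝ)`
(`UnitaryGroupArchRealPair.archAtRealSplit`, `g ↦ g_{w(k)} = g₊`) acts on `W_v` through the Siegel Levi after the
split Cayley element `κ_k = splitCayleyDot` (`ArchSplitPlaceLeviSection`, L2–L5 of the general-`E/F` programme):

* `rsLeviFamily : U(J)(E ⊗ ℝ) →* ∏_k GL_N(ℝ)`, `g ↦ (g_{w(k)})_k` (continuous), `rsKappaFamily k = splitCayleyDot`;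
* **`rsPlacesSection x := placeLeviSection … rsLeviFamily x : U(J)(E ⊗ ℝ) →* Mp^𝓢(ℝ^{N × κ})`** for a lift `x` of
  `placeSp κ⁻¹` (`exists_rsPlacesSection_lift`); it lies over the slice-by-slice symplectic embeddings
  `toSymplecticDotSplitReal (archAtRealSplit (w k) g)` (`coe_proj_rsPlacesSection`, by `toSymplecticDot_eq_conj_levi`);
  strongly continuous (`continuous_rsPlacesSection_snd_apply`); independent of the lift;
* **`quot_rsPlacesSection : quot = ∏_k sgn det g_{w(k)}`** (`ArchLeviSectionQuotientSign.quot_leviGL_eq_ite` on the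
  block diagonal; `ite_pos_prod_eq_prod_ite`) — the sign character of the type-(ii) places.

Topic `NumberTheory/Weil1964`; KERNEL only: definitions with bodies and theorems; no `def … : Prop`, no named fact,
no `sorry`.  Written for the stage-1 cell `pub-hodgecm` (GR lane); nothing here is a claim of the manuscripts
adjudicated by that cell.

## References
* G. B. Folland, *Harmonic Analysis in Phase Space* (1989), §4.2 (4.24), Thm. (4.37) [Folland1989].
* S. S. Kudla, Israel J. Math. 87 (1994), §3 [Kudla1994].
* C. Mœglin, M.-F. Vignéras, J.-L. Waldspurger, LNM 1291 (1987), Chap. 1 I.17, Chap. 2 III.1 [MoeglinVignerasWaldspurger1987].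
* S. S. Kudla, *Notes on the local theta correspondence* (1996), Chap. I §2 [Kudla1996].
-/

set_option autoImplicit false

noncomputable section

open scoped Matrix Classical
open Matrix NumberField NumberField.InfinitePlace NumberField.mixedEmbedding
open Literature.RepresentationTheory.HeisenbergGroup
open Literature.RepresentationTheory.HeisenbergGroup.SymplecticMatrix
open Literature.Analysis.SegalBargmann
open Literature.NumberTheory.Automorphic Literature.NumberTheory.Automorphic.UnitaryGroup

namespace Literature.NumberTheory.Weil1964

local notation "PV" σ => (σ → ℝ) × (σ → ℝ)
local notation "SpR" σ => symplecticGroup (polar (dotPairing σ))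

variable (F : Type) [Field F] [NumberField F] (E : Type) [Field E] [NumberField E] [Algebra F E] (c : E ≃ₐ[F] E)
  (hcc : c * c = 1)
  (N : ℕ) (T₀ : Matrix (Fin N) (Fin N) F) (hT : T₀.IsSymm) (hTd : IsUnit T₀.det)
  {J : Matrix (Fin N) (Fin N) E} (hJ : J = T₀.map (algebraMap F E)) {δ : E} (hδ : δ ≠ 0)
  {κ : Type} (wOfS : κ → {w : InfinitePlace E // w.IsReal})

/-! ## §1 The Levi family over the split real places -/

section Family

/-- the Gram matrix of the factor at `k`: `σ_{w(k)}(T₀) ∈ M_N(ℝ)`. [cite: MoeglinVignerasWaldspurger1987, Chap. 1 I.17] -/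
abbrev rsGram (k : κ) : Matrix (Fin N) (Fin N) ℝ := T₀.map (realEmbOfPlace F E (wOfS k))

omit [NumberField F] [NumberField E] in
include hTd in
/-- `det σ_{w(k)}(T₀)` is a unit. [cite: MoeglinVignerasWaldspurger1987, Chap. 1 I.17] -/
theorem isUnit_det_rsGram (k : κ) : IsUnit (rsGram F E N T₀ wOfS k).det := isUnit_det_map _ hTd

omit [NumberField F] [NumberField E] in
include hT in
/-- `σ_{w(k)}(T₀)` is symmetric. [cite: MoeglinVignerasWaldspurger1987, Chap. 1 I.17] -/
theorem isSymm_rsGram (k : κ) : (rsGram F E N T₀ wOfS k).IsSymm := hT.map _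

/-- `s_k = σ_{w(k)}(δ) ∈ ℝ`. [cite: MoeglinVignerasWaldspurger1987, Chap. 1 I.17] -/
abbrev rsDelta (δ : E) (k : κ) : ℝ := embedding_of_isReal (wOfS k).2 δ

omit [NumberField F] [NumberField E] [Algebra F E] in
include hδ in
/-- `s_k ≠ 0`. [cite: MoeglinVignerasWaldspurger1987, Chap. 1 I.17] -/
theorem rsDelta_ne_zero (k : κ) : rsDelta E wOfS δ k ≠ 0 := embedding_of_isReal_ne_zero E (wOfS k) hδ

/-- **the Levi family** `g ↦ (g_{w(k)})_k ∈ ∏_k GL_N(ℝ)` (`g₊ = plusGL (archAtRealSplit w(k) g) = g_{w(k)}`).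
[cite: Folland1989, §4.2 (4.24); MoeglinVignerasWaldspurger1987, Chap. 1 I.17] -/
def rsLeviFamily : arch F E c N J →* (κ → GL (Fin N) ℝ) :=
  MonoidHom.pi fun k =>
    ((((isQuadraticCoordinates_splitReal (rsDelta E wOfS δ k) (rsDelta_ne_zero E hδ wOfS k)).plusGL rfl (Fin N)).comp
      (unitaryGroupOfForm _ _).subtype).comp (archAtRealSplit F E c N hcc (wOfS k) T₀ hJ))

omit [NumberField F] [NumberField E] in
/-- the component at `k`. [cite: Folland1989, §4.2 (4.24)] -/
theorem rsLeviFamily_apply (g : arch F E c N J) (k : κ) :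
    rsLeviFamily F E c hcc N T₀ hJ hδ wOfS g k =
      (isQuadraticCoordinates_splitReal (rsDelta E wOfS δ k) (rsDelta_ne_zero E hδ wOfS k)).plusGL rfl (Fin N)
        (archAtRealSplit F E c N hcc (wOfS k) T₀ hJ g : unitaryGroupOfForm _ _) := rfl

omit [NumberField F] [NumberField E] in
/-- the matrix of the component at `k` is `g_{w(k)} = (g_{ij})_{w(k)}`. [cite: Folland1989, §4.2 (4.24)] -/
theorem coe_rsLeviFamily (g : arch F E c N J) (k : κ) :
    ((rsLeviFamily F E c hcc N T₀ hJ hδ wOfS g k : GL (Fin N) ℝ) : Matrix (Fin N) (Fin N) ℝ) =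
      (((g : GL (Fin N) (mixedSpace E)) : Matrix (Fin N) (Fin N) (mixedSpace E))).map (evalR E (wOfS k)) :=
  Matrix.ext fun i j => coe_plusGL_archAtRealSplit F E c N hcc (wOfS k) T₀ hJ hδ g i j

omit [NumberField F] [NumberField E] in
/-- continuity of `g ↦ g₊` at `k` into `GL_N(ℝ)`. [cite: BorelJacquet1979, §4.1] -/
theorem continuous_plusGL_archAtRealSplit (k : κ) :
    Continuous fun g : arch F E c N J =>
      (isQuadraticCoordinates_splitReal (rsDelta E wOfS δ k) (rsDelta_ne_zero E hδ wOfS k)).plusGL rfl (Fin N)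
        (archAtRealSplit F E c N hcc (wOfS k) T₀ hJ g : unitaryGroupOfForm _ _) := by
  have hev : Continuous ((isQuadraticCoordinates_splitReal (rsDelta E wOfS δ k) (rsDelta_ne_zero E hδ wOfS k)).evalPlus
      rfl : ℝ × ℝ → ℝ) :=
    continuous_fst.congr fun z => (evalPlus_splitReal _ _ z).symm
  exact ((hev.generalLinearGroup_map : Continuous (Matrix.GeneralLinearGroup.map (n := Fin N) _)).comp
    continuous_subtype_val).comp (continuous_archAtRealSplit F E c N hcc (wOfS k) T₀ hJ)

omit [NumberField F] [NumberField E] in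
/-- the component at `k` is entrywise continuous. [cite: BorelJacquet1979, §4.1] -/
theorem continuous_coe_rsLeviFamily (k : κ) :
    Continuous fun g : arch F E c N J =>
      ((rsLeviFamily F E c hcc N T₀ hJ hδ wOfS g k : GL (Fin N) ℝ) : Matrix (Fin N) (Fin N) ℝ) :=
  Units.continuous_val.comp (continuous_plusGL_archAtRealSplit F E c hcc N T₀ hJ hδ wOfS k)

omit [NumberField F] [NumberField E] in
/-- the inverse of the component at `k` is entrywise continuous. [cite: BorelJacquet1979, §4.1] -/
theorem continuous_coe_rsLeviFamily_inv (k : κ) :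
    Continuous fun g : arch F E c N J =>
      (((rsLeviFamily F E c hcc N T₀ hJ hδ wOfS g k)⁻¹ : GL (Fin N) ℝ) : Matrix (Fin N) (Fin N) ℝ) :=
  Units.continuous_coe_inv.comp (continuous_plusGL_archAtRealSplit F E c hcc N T₀ hJ hδ wOfS k)

/-- **the Cayley family** `κ_k = splitCayleyDot (σ_{w(k)} T₀)`. [cite: MoeglinVignerasWaldspurger1987, Chap. 2 III.1] -/
def rsKappaFamily (k : κ) : SpR (Fin N) :=
  splitCayleyDot (two_mul_mul_inv_two_mul (rsDelta E wOfS δ k) (rsDelta_ne_zero E hδ wOfS k)) (Fin N)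
    (isUnit_det_rsGram F E N T₀ hTd wOfS k) (isSymm_rsGram F E N T₀ hT wOfS k)

end Family

/-! ## §2 The section over the split real places -/

section Section

variable [Fintype κ] [DecidableEq κ]

/-- **`rsPlacesSection x : U(J)(E ⊗ ℝ) →* Mp^𝓢(ℝ^{N × κ})`** — the conjugated Levi section over the split real
places at once. [cite: Folland1989, §4.2 (4.24); Kudla1994, §3] -/
def rsPlacesSection (x : MpS (Fin N × κ)) : arch F E c N J →* MpS (Fin N × κ) :=
  placeLeviSection (Fin N) κ (rsLeviFamily F E c hcc N T₀ hJ hδ wOfS) x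

omit [NumberField F] [NumberField E] in
/-- **a lift of `placeSp κ⁻¹` exists.** [cite: Folland1989, §4.2 Prop. (4.39)] -/
theorem exists_rsPlacesSection_lift :
    ∃ x : MpS (Fin N × κ), MpS.proj x = placeSp fun k => (rsKappaFamily F E N T₀ hT hTd hδ wOfS k)⁻¹ :=
  exists_placeLeviSection_lift _

omit [NumberField F] [NumberField E] in
/-- **THE SECTION LIES OVER THE FACTORS**: for a lift `x` of `placeSp κ⁻¹`,
`⇑(proj (rsPlacesSection x g)) = placePhase (k ↦ ⇑(toSymplecticDotSplitReal (archAtRealSplit w(k) g)))`.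
[cite: Kudla1994, §3; MoeglinVignerasWaldspurger1987, Chap. 2 III.1] -/
theorem coe_proj_rsPlacesSection (x : MpS (Fin N × κ))
    (hx : MpS.proj x = placeSp fun k => (rsKappaFamily F E N T₀ hT hTd hδ wOfS k)⁻¹) (g : arch F E c N J) :
    (⇑(((MpS.proj (rsPlacesSection F E c hcc N T₀ hJ hδ wOfS x g) : SpR (Fin N × κ)).1 :
        (PV (Fin N × κ)) ≃ₗ[ℝ] PV (Fin N × κ))) : PhaseMap (Fin N × κ)) =
      placePhase fun k => ⇑(((toSymplecticDotSplitReal (rsDelta E wOfS δ k) (rsDelta_ne_zero E hδ wOfS k) (Fin N)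
          (isUnit_det_rsGram F E N T₀ hTd wOfS k) rfl (isSymm_rsGram F E N T₀ hT wOfS k)
          (archAtRealSplit F E c N hcc (wOfS k) T₀ hJ g) : SpR (Fin N)).1 : (PV (Fin N)) ≃ₗ[ℝ] PV (Fin N))) := by
  rw [rsPlacesSection, coe_proj_placeLeviSection _ _ x hx]
  congr 1
  funext k
  rw [toSymplecticDot_eq_conj_levi (isQuadraticCoordinates_splitReal (rsDelta E wOfS δ k) (rsDelta_ne_zero E hδ wOfS k))
    rfl (two_mul_mul_inv_two_mul (rsDelta E wOfS δ k) (rsDelta_ne_zero E hδ wOfS k)) (Fin N)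
    (isUnit_det_rsGram F E N T₀ hTd wOfS k) swap_diag (swap_delta (rsDelta E wOfS δ k)) rfl
    (isSymm_rsGram F E N T₀ hT wOfS k)]
  rfl

omit [NumberField F] [NumberField E] in
/-- **strong continuity** of the section (the `hsc` input of `continuous_archLift`).
[cite: Folland1989, §4.2 (4.24); Weil1964, Chap. III n° 39 p. 189] -/
theorem continuous_rsPlacesSection_snd_apply (x : MpS (Fin N × κ)) (f : SchwartzMap ((Fin N × κ) → ℝ) ℂ) :
    Continuous fun g : arch F E c N J => (rsPlacesSection F E c hcc N T₀ hJ hδ wOfS x g).1.2 f :=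
  continuous_placeLeviSection_snd_apply _ x (continuous_coe_rsLeviFamily_inv F E c hcc N T₀ hJ hδ wOfS) f

omit [NumberField F] [NumberField E] in
/-- continuity of the `π`-orbit maps of the section. [cite: Weil1964, Chap. III n° 39 p. 189] -/
theorem continuous_proj_rsPlacesSection_apply (x : MpS (Fin N × κ)) (w : PV (Fin N × κ)) :
    Continuous fun g : arch F E c N J =>
      ((MpS.proj (rsPlacesSection F E c hcc N T₀ hJ hδ wOfS x g) : SpR (Fin N × κ)) :
        (PV (Fin N × κ)) ≃ₗ[ℝ] PV (Fin N × κ)) w :=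
  continuous_proj_placeLeviSection_apply _ x (continuous_coe_rsLeviFamily F E c hcc N T₀ hJ hδ wOfS)
    (continuous_coe_rsLeviFamily_inv F E c hcc N T₀ hJ hδ wOfS) w

omit [NumberField F] [NumberField E] in
/-- **independence of the lift.** [cite: Kudla1996, Chap. I §2 Remark] -/
theorem rsPlacesSection_eq_of_proj_eq {x y : MpS (Fin N × κ)} (hxy : MpS.proj x = MpS.proj y) :
    rsPlacesSection F E c hcc N T₀ hJ hδ wOfS y = rsPlacesSection F E c hcc N T₀ hJ hδ wOfS x :=
  placeLeviSection_eq_of_proj_eq _ hxy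

end Section

/-! ## §3 The quotient character: `∏_k sgn det g_{w(k)}` -/

section Quot

variable [Fintype κ] [DecidableEq κ]

/-- the sign of a product of non-zero reals is the product of the signs (as `±1 ∈ ℂ`). [cite: Folland1989, §4.2 Thm. (4.37)] -/
theorem ite_pos_prod_eq_prod_ite {ι : Type*} (s : Finset ι) (d : ι → ℝ) (hd : ∀ i ∈ s, d i ≠ 0) :
    (if 0 < ∏ i ∈ s, d i then (1 : ℂ) else -1) = ∏ i ∈ s, (if 0 < d i then (1 : ℂ) else -1) := by
  induction s using Finset.cons_induction with
  | empty => simp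
  | cons a s ha ih =>
    rw [Finset.prod_cons, Finset.prod_cons, ← ih fun i hi => hd i (Finset.mem_cons_of_mem hi)]
    have ha0 : d a ≠ 0 := hd a (Finset.mem_cons_self a s)
    have hs0 : ∏ i ∈ s, d i ≠ 0 := Finset.prod_ne_zero_iff.2 fun i hi => hd i (Finset.mem_cons_of_mem hi)
    rcases lt_or_gt_of_ne ha0 with h | h
    · rw [if_neg (not_lt.2 h.le)]
      rcases lt_or_gt_of_ne hs0 with h' | h'
      · rw [if_neg (not_lt.2 h'.le), if_pos (mul_pos_of_neg_of_neg h h')]; norm_num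
      · rw [if_pos h', if_neg (not_lt.2 (mul_neg_of_neg_of_pos h h').le)]; norm_num
    · rw [if_pos h]
      rcases lt_or_gt_of_ne hs0 with h' | h'
      · rw [if_neg (not_lt.2 h'.le), if_neg (not_lt.2 (mul_neg_of_pos_of_neg h h').le)]; norm_num
      · rw [if_pos h', if_pos (mul_pos h h')]; norm_num

omit [NumberField F] [NumberField E] in
/-- **`quot (rsPlacesSection x g) = ∏_k sgn det g_{w(k)}`** — the quotient character of the type-(ii) block is the
product of the signs of the determinants of the components `g_{w(k)} ∈ GL_N(ℝ)` (independent of the lift `x`).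
[cite: Folland1989, §4.2 Thm. (4.37); Kudla1994, §3] -/
theorem quot_rsPlacesSection (x : MpS (Fin N × κ)) (g : arch F E c N J) :
    MpS.quot (rsPlacesSection F E c hcc N T₀ hJ hδ wOfS x g) =
      ∏ k : κ, (if 0 < ((((g : GL (Fin N) (mixedSpace E)) : Matrix (Fin N) (Fin N) (mixedSpace E))).map (evalR E (wOfS k))).det
        then (1 : ℂ) else -1) := by
  rw [rsPlacesSection, placeLeviSection_apply, MpS.quot_conj, quot_leviGL_eq_ite, GL.coe_placeDiag, Matrix.det_blockDiagonal]
  simp only [coe_rsLeviFamily]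
  refine ite_pos_prod_eq_prod_ite _ _ fun k _ => ?_
  rw [← coe_rsLeviFamily F E c hcc N T₀ hJ hδ wOfS g k]
  exact (Matrix.isUnits_det_units _).ne_zero

end Quot

end Literature.NumberTheory.Weil1964

end
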